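import Mathlib.Analysis.SpecialFunctions.Pow.Real
import Mathlib.Analysis.SpecialFunctions.Log.Basic
import Mathlib.Order.LiminfLimsup
import Mathlib.Topology.Algebra.InfiniteSum.Basic
import Mathlib.Topology.Order.OrderClosed
import Literature.NumberTheory.EllipticCurves.Newforms
import HarnessLib

/-!
# Deligne–Serre 1974, §5: Rankin's estimate and eigenvalues of weight-one eigenforms

Deligne–Serre, *Formes modulaires de poids 1*, Ann. Sci. ÉNS (4) 7 (1974), §5 ("Exploitation
d'un résultat de Rankin"), the analytic input of the proof of their Thm. 4.1: for a weight-one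
eigenform the Hecke eigenvalues `a_p` take only finitely many values outside a set of primes
of arbitrarily small upper density (Prop. 5.5), which feeds property C(η, M) of the images of the
mod-`ℓ` representations (Lemme 8.3). Vendored as named facts (D-0014):

* `Literature.ModularForms.upperDensity X` — the upper (analytic) density (5.4.1)
  `dens.sup X = limsup_{s → 1, s > 1} (∑_{p ∈ X} p^{-s}) / log (1/(s-1))` of a set of primes `X`.
* `Literature.NumberTheory.EllipticCurves.ModularForms.DeligneSerre1974.prop51` — **Prop. 5.1** (Rankin): for a non-zero cusp
  form `f` of type `(k, ε)` on `Γ₀(N)` which is an eigenfunction of the `T_p`, `p ∤ N`, with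
  eigenvalues `a_p`, the series `∑_{p ∤ N} |a_p|² p^{-s}` converges for real `s > k` and
  `∑_{p ∤ N} |a_p|² p^{-s} ≤ log (1/(s-k)) + O(1)` as `s → k`.
* `Literature.NumberTheory.EllipticCurves.ModularForms.DeligneSerre1974.prop55` — **Prop. 5.5**: if moreover `k = 1`, then for
  every `η > 0` there are a set of primes `X_η` with `dens.sup X_η ≤ η` and a finite set
  `Y_η ⊆ ℂ` with `a_p ∈ Y_η` for `p ∉ X_η`.

## Design notes

* "`f` parabolique de type `(k, ε)` sur `Γ₀(N)`" is `f : CuspForm (Gamma1 N) k` with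
  `f ∈ nebentypusSubspace N k ε` (`Literature.NumberTheory.EllipticCurves.Newforms`); "fonction
  propre des `T_p`, `p ∤ N`, de valeurs propres `a_p`" is `T_p f = a • f` for some `a`
  (`heckeT (Gamma1 N) k p`), the eigenvalue being `heckeEigenvalue f p`.
* Sums over primes `p ∤ N` are written as sums over `ℕ` of a summand vanishing off
  `{p prime, p ∤ N}` (`rankinTerm`); "`≤ log (1/(s-k)) + O(1)` pour `s → k`" is: for some
  constant `C`, eventually as `s → k⁺`. In Prop. 5.5 the conclusion `a_p ∈ Y_η` is asserted for
  the primes `p ∤ N` outside `X_η` (the `a_p` of the statement are the `T_p`-eigenvalues,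
  `p ∤ N`).
* The upper density (5.4.1) is the *analytic* (Dirichlet) upper density, a `Filter.limsup` at
  `𝓝[>] 1` of a real function; the source notes it lies in `[0, 1]` and (Rem. 5.6) that the
  natural density could be used instead. Literature's `WeierstrassCurve.HasPrimeDensity`
  (`Literature.NumberTheory.EllipticCurves.SupersingularDensity`) is the natural density of a
  set of primes *having* a density — a different notion, not used here.
* Mathlib has neither Rankin–Selberg convolutions nor densities of sets of primes (searched
  `Rankin`, `density` — only `schnirelmannDensity` and matroid ranks).

## References

* P. Deligne, J.-P. Serre, *Formes modulaires de poids 1*, Ann. Sci. ÉNS (4) 7 (1974), 507–530,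
  Prop. 5.1 (p. 518), (5.4.1) and Prop. 5.5 (pp. 519–520).
* R. A. Rankin, *Contributions to the theory of Ramanujan's function τ(n) and similar
  arithmetical functions II*, Proc. Cambridge Philos. Soc. 35 (1939), 357–372.
-/

noncomputable section

open scoped MatrixGroups ModularForm Topology

open CongruenceSubgroup Filter

namespace Literature.NumberTheory.EllipticCurves.ModularForms

open Classical in
/-- The **upper density** of a set `X` of primes (Deligne–Serre 1974, (5.4.1)):
`dens.sup X = limsup_{s → 1, s > 1} (∑_{p ∈ X} p^{-s}) / log (1/(s - 1))`, the sum ranging over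
the primes in `X` (non-primes in `X` are ignored). [cite: DeligneSerreASENS1974, (5.4.1)] -/
def upperDensity (X : Set ℕ) : ℝ :=
  limsup (fun s : ℝ ↦
    (∑' p : ℕ, if p.Prime ∧ p ∈ X then (p : ℝ) ^ (-s) else 0) / Real.log (1 / (s - 1)))
    (𝓝[>] (1 : ℝ))

/-- The empty set of primes has upper density `0`. [folklore] -/
lemma upperDensity_empty : upperDensity ∅ = 0 := by
  simp [upperDensity]

namespace DeligneSerre1974

/-- The summand `|a_p|² p^{-s}` of Rankin's series, extended by `0` off the primes `p ∤ N`.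
[cite: DeligneSerreASENS1974, Prop. 5.1] -/
def rankinTerm {N : ℕ} [NeZero N] {k : ℤ} (f : CuspForm (Gamma1 N) k) (s : ℝ) (p : ℕ) : ℝ :=
  if p.Prime ∧ ¬ p ∣ N then ‖heckeEigenvalue f p‖ ^ 2 * (p : ℝ) ^ (-s) else 0

/-- `rankinTerm` is non-negative. [folklore] -/
lemma rankinTerm_nonneg {N : ℕ} [NeZero N] {k : ℤ} (f : CuspForm (Gamma1 N) k) (s : ℝ)
    (p : ℕ) : 0 ≤ rankinTerm f s p := by
  unfold rankinTerm
  split_ifs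
  · positivity
  · exact le_rfl

/-- **Deligne–Serre 1974, Prop. 5.1** (after Rankin). Let `f` be a cusp form of type `(k, ε)`
on `Γ₀(N)`, not identically zero, which is an eigenfunction of the `T_p`, `p ∤ N`, with
eigenvalues `a_p`. Then the series `∑_{p ∤ N} |a_p|² p^{-s}` converges for real `s > k`, and
`∑_{p ∤ N} |a_p|² p^{-s} ≤ log (1/(s - k)) + O(1)` for `s → k` (5.1.1).
[cite: DeligneSerreASENS1974, Prop. 5.1] -/
def prop51 : Prop :=
  ∀ ⦃N : ℕ⦄ [NeZero N] ⦃k : ℤ⦄ (ε : DirichletCharacter ℂ N) (f : CuspForm (Gamma1 N) k),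
    f ∈ nebentypusSubspace N k ε → f ≠ 0 →
    (∀ p : ℕ, (hp : p.Prime) → ¬ p ∣ N →
      ∃ a : ℂ, (haveI : NeZero p := ⟨hp.ne_zero⟩; heckeT (Gamma1 N) k p f) = a • f) →
    (∀ s : ℝ, (k : ℝ) < s → Summable (rankinTerm f s)) ∧
      ∃ C : ℝ, ∀ᶠ s : ℝ in 𝓝[>] (k : ℝ),
        ∑' p : ℕ, rankinTerm f s p ≤ Real.log (1 / (s - k)) + C

/-- **Deligne–Serre 1974, Prop. 5.5.** Keep the hypotheses of Prop. 5.1 and suppose moreover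
that the weight `k` of `f` is `1`. Then for every `η > 0` there are a set `X_η` of primes and a
finite subset `Y_η` of `ℂ` such that `dens.sup X_η ≤ η` (upper density (5.4.1)) and
`a_p ∈ Y_η` for `p ∉ X_η` (`p ∤ N`). [cite: DeligneSerreASENS1974, Prop. 5.5] -/
def prop55 : Prop :=
  ∀ ⦃N : ℕ⦄ [NeZero N] (ε : DirichletCharacter ℂ N) (f : CuspForm (Gamma1 N) 1),
    f ∈ nebentypusSubspace N 1 ε → f ≠ 0 →
    (∀ p : ℕ, (hp : p.Prime) → ¬ p ∣ N →
      ∃ a : ℂ, (haveI : NeZero p := ⟨hp.ne_zero⟩; heckeT (Gamma1 N) 1 p f) = a • f) →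
    ∀ η : ℝ, 0 < η →
      ∃ (X : Set ℕ) (Y : Finset ℂ), upperDensity X ≤ η ∧
        ∀ p : ℕ, p.Prime → ¬ p ∣ N → p ∉ X → heckeEigenvalue f p ∈ Y

end DeligneSerre1974

end Literature.NumberTheory.EllipticCurves.ModularForms
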